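import Literature.AnabelianGeometry.SemiGraphs.ArithTemperedGroupConjugators
import Literature.AnabelianGeometry.SemiGraphs.SubgroupPresentationArithCompat
import Literature.AnabelianGeometry.SemiGraphs.TemperedPiPresentation
import Literature.AnabelianGeometry.SemiGraphs.TemperedPiVerticialLevelData
import Literature.AnabelianGeometry.SemiGraphs.TemperedReconstructionR3cProofs
import Literature.AnabelianGeometry.SemiGraphs.TemperedVerticialDistinctSameVertex

/-!
# [SemiAnbd] Thm 5.4, producer row T54-B: the `IsArithCompatible` input `hP` of the arithmetic tree tower
# for the OUTER SEMI-DIRECT PRODUCT MODEL — the vertex-conjugator field PROVED, the rest named in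
# presentation currency (proof-only)

Mochizuki, *Semi-graphs of anabelioids*, Publ. RIMS **42** (2006), §5 p. 65 ll. 4–14 (the decomposition
groups `Π^temp_{𝔊,v} ⊆ Π^temp_𝔊` "well-defined up to conjugation"), Thm 5.4 p. 66
[cite: MochizukiSemiAnbd2006, §5, p. 65].  abc-iut cell, layer L3, GAP-LEDGER row G-w4d053-1 (T54-B);
seat abc-iut-w4-d082 gen 3 (lineage: the outer model `Π^temp_𝔊 := π₁^temp(𝒢) ⋊^out_ρ Π_A`, p416276 /
p418674).  PROOF-ONLY (no definition, no named fact).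

abc-iut-L3-d4's arithmetic tree tower (`ArithTreeTower.lean`, p421550; D-row 2026-08-26T04:26:54Z) takes
as input `hP : (D.piPresentation h𝒢 T R).IsArithCompatible Φ σ` for the presentation of `𝔾` inside
`π₁^temp(𝒢)` attached to compatible point sequences `T` and reference branches `R`
(`TemperedPiPresentation.lean`: `H_w := range (T w).decompHom`, `M_e`, `s_b`) — "not yet written" for
any model.  For the outer model (`E := outerSemidirectProduct ρ`, `Φ e :=` the `Aut`-component of `e`,
`σ := baseAct ∘ aug`) this file

* PROVES the field `exists_isVConj` (`piPresentation_exists_isVConj_outerAction`): since every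
  `H_w = range (T w).decompHom` IS a verticial subgroup at `w` (abc-iut-L3-t6/t9,
  `PointSeq.range_decompHom_mem_verticialSubgroups`, Thm 3.7 (i)), the vertex conjugators exist by this
  lineage's `exists_vConj_outerAction` (p418674) from the chart-action binder `hV` (Prop 3.6 (iv) at
  `ρ_𝔾(a)`, outer form — the ONE inline binder of p416276) and "one conjugacy class of verticial subgroups
  per vertex" (abc-iut-L3-t11);
* PROVES that the edge subgroups `M_ε` are edge-like (`piPresentation_M_mem_edgeLikeSubgroups`, via
  abc-iut-L3-t8's `isEdgeHom_comp_brHom`) and hence the CONTAINMENT clause of `exists_isEConj`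
  (`piPresentation_exists_eConj_fst_outerAction`, from the edge binder `hE` by p418674's
  `exists_eConj_outerAction`);
* ASSEMBLES `IsArithCompatible` (`isArithCompatible_piPresentation_outerAction`) from that theorem and
  the remaining inputs stated VERBATIM in the presentation's currency: self-normalisation of the `H_w`
  (Cor 2.7 (i) / Thm 3.7 (iii) commensurable terminality of verticial subgroups — binder `hCT`), `𝔾` a
  graph (`IsGraph`), the two-branch description of `M_e` (Thm 3.7 (iv) clause 2 — binder `hEI`) and the
  edge conjugators with their branch clause (binder `hEc`; its containment clause is p418674's
  `exists_eConj_outerAction` once `M_e ∈ edgeLikeSubgroups` is recorded for the presentation, the branch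
  clause is the (BR) currency of p417059 — both left in `IsEConj` form here).
* and, under the hypotheses of Thm 3.7 (`Thm37Hypotheses`), PROVES the field `selfNormalizing`
  (`piPresentation_selfNormalizing`: verticial subgroups are commensurably terminal — Thm 3.7 (iii),
  DISCHARGED in the tree as `verticialDistinct_holds` / `mem_of_map_conj_eq_of_mem_verticialSubgroups`)
  and assembles `isArithCompatible_piPresentation_outerAction_of_thm37` with inputs {hV, hG, hEI, hEc}.
So the tower's `hP` for the outer model is reduced to {hV, hEI, hEc} (+ `𝔾` a graph) with the
vertex-conjugator and self-normalisation fields discharged.  Nothing here takes a side on [IUTchIII] Cor 3.12; typed ≠ proved for Thm 5.4.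
-/

namespace Literature.AnabelianGeometry.SemiGraphs

open Literature.AnabelianGeometry.EtaleTheta
open CategoryTheory

universe u w

namespace ProfiniteSemiGraph

variable {𝒢 : ProfiniteSemiGraph.{u}} (h36 : 𝒢.Prop36Hypotheses)
  {PA : Type w} [Group PA] (ρ : PA →* TopOut (𝒢.temperedPiChart h36).G)
  (baseAct : PA →* Aut 𝒢.graph)
  (T : ∀ w : 𝒢.graph.Vertex, (𝒢.galoisLevelData h36).PointSeq h36.isCountable w)
  (R : SemiGraph.RefBranches 𝒢.graph)

/-- **Field `exists_isVConj` of `IsArithCompatible` for the presentation of `𝔾` in `π₁^temp(𝒢)` and the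
outer semi-direct product model — PROVED**: for every `e ∈ π₁^temp(𝒢) ⋊^out_ρ Π_A` and every vertex `w`
there is `k ∈ π₁^temp(𝒢)` with `x ∈ H_w ↔ k⁻¹ · φ_e(x) · k ∈ H_{(aug e)·w}` (`Φ e :=` the `Aut`-component,
`σ := baseAct ∘ aug`), from the chart-action binder `hV` — because `H_w = range (T w).decompHom` is a
verticial subgroup at `w` (Thm 3.7 (i)). [cite: MochizukiSemiAnbd2006, §5, p. 65] -/
theorem piPresentation_exists_isVConj_outerAction
    (hV : ∀ (a : PA) (v : 𝒢.graph.Vertex) (H : Subgroup (𝒢.temperedPiChart h36).G),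
      H ∈ verticialSubgroups (𝒢.temperedPiChart h36) v →
      ∃ φ : contMulAut (𝒢.temperedPiChart h36).G, TopOut.mk _ φ = ρ a ∧
        H.map (φ : MulAut (𝒢.temperedPiChart h36).G).toMonoidHom ∈
          verticialSubgroups (𝒢.temperedPiChart h36) ((baseAct a).hom.vertexMap v))
    (e : outerSemidirectProduct ρ) (w : 𝒢.graph.Vertex) :
    ∃ k : (𝒢.temperedPiChart h36).G,
      ((𝒢.galoisLevelData h36).piPresentation h36.isCountable T R).IsVConj
        (((contMulAut (𝒢.temperedPiChart h36).G).subtype.comp (MonoidHom.fst _ _)).comp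
          (outerSemidirectProduct ρ).subtype)
        (baseAct.comp (outerSemidirectProductSnd ρ)) e w k :=
  exists_vConj_outerAction (𝒢.temperedPiChart h36) ρ baseAct hV
    (fun w => ((𝒢.galoisLevelData h36).piPresentation h36.isCountable T R).H w)
    (fun w => (T w).range_decompHom_mem_verticialSubgroups) e w


/-- **The edge subgroups of the presentation are edge-like**: `M_ε = (T (ν ε)).decompHom (Π_{β ε})` is
the image of the EDGE homomorphism `decompHom ∘ (β ε)_*` (a verticial homomorphism composed with a branch
map, abc-iut-L3-t8 `isEdgeHom_comp_brHom`), at the edge `edgeOf (β ε) = ε`.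
[cite: MochizukiSemiAnbd2006, Thm 3.7(iii) p.41] -/
theorem piPresentation_M_mem_edgeLikeSubgroups (ε : 𝒢.graph.Edge) :
    ((𝒢.galoisLevelData h36).piPresentation h36.isCountable T R).M ε ∈
      edgeLikeSubgroups (𝒢.temperedPiChart h36) ε := by
  have hmem : ((𝒢.branchSubgroup (R.β ε) (R.ν ε) (R.abuts_β ε)).map (T (R.ν ε)).decompHom) ∈
      edgeLikeSubgroups (𝒢.temperedPiChart h36) (𝒢.graph.edgeOf (R.β ε)) :=
    ⟨(T (R.ν ε)).decompHomCont.comp (𝒢.brHom (R.β ε) (R.ν ε) (R.abuts_β ε)),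
      isEdgeHom_comp_brHom _ (R.abuts_β ε) (T (R.ν ε)).isVerticialHom_decompHomCont, by
        rw [branchSubgroup, MonoidHom.map_range]; rfl⟩
  rw [R.edgeOf_β] at hmem
  simpa only [GaloisLevelData.piPresentation_M] using hmem

/-- **Edge conjugators, containment clause, for the presentation and the outer model — PROVED** (the
first conjunct of `IsEConj`, in the exact `↔` form): for every `e` and edge `ε` there is `m ∈ π₁^temp(𝒢)`
with `x ∈ M_ε ↔ m⁻¹ · φ_e(x) · m ∈ M_{(aug e)·ε}`, from the edge chart-action binder `hE` (Prop 3.6 (iv)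
at `ρ_𝔾(a)` on edge-like subgroups), by this lineage's `exists_eConj_outerAction` (p418674) and
`piPresentation_M_mem_edgeLikeSubgroups`.  (The branch clause of `IsEConj` is the (BR) currency and is
NOT derived here.) [cite: MochizukiSemiAnbd2006, §5, p. 65] -/
theorem piPresentation_exists_eConj_fst_outerAction
    (hE : ∀ (a : PA) (ε : 𝒢.graph.Edge) (K : Subgroup (𝒢.temperedPiChart h36).G),
      K ∈ edgeLikeSubgroups (𝒢.temperedPiChart h36) ε →
      ∃ φ : contMulAut (𝒢.temperedPiChart h36).G, TopOut.mk _ φ = ρ a ∧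
        K.map (φ : MulAut (𝒢.temperedPiChart h36).G).toMonoidHom ∈
          edgeLikeSubgroups (𝒢.temperedPiChart h36) ((baseAct a).hom.edgeMap ε))
    (e : outerSemidirectProduct ρ) (ε : 𝒢.graph.Edge) :
    ∃ m : (𝒢.temperedPiChart h36).G, ∀ x,
      x ∈ ((𝒢.galoisLevelData h36).piPresentation h36.isCountable T R).M ε ↔
        m⁻¹ * (e.1.1 : MulAut (𝒢.temperedPiChart h36).G) x * m ∈
          ((𝒢.galoisLevelData h36).piPresentation h36.isCountable T R).M
            ((baseAct (outerSemidirectProductSnd ρ e)).hom.edgeMap ε) :=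
  exists_eConj_outerAction (𝒢.temperedPiChart h36) ρ baseAct hE
    (fun ε => ((𝒢.galoisLevelData h36).piPresentation h36.isCountable T R).M ε)
    (piPresentation_M_mem_edgeLikeSubgroups h36 T R) e ε

/-- **`IsArithCompatible` for the presentation of `𝔾` in `π₁^temp(𝒢)` and the outer model, ASSEMBLED**
(the input `hP` of abc-iut-L3-d4's `ArithTreeTower`): the vertex-conjugator field is the theorem above;
the other fields are the printed inputs stated verbatim in the presentation's currency — `hCT`
self-normalisation of the `H_w` (Cor 2.7 (i) / Thm 3.7 (iii): verticial subgroups are commensurably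
terminal), `hG` (`𝔾` is a graph: every branch abuts), `hEI` (Thm 3.7 (iv) clause 2: `M_e` is the meet of
its two positioned vertex subgroups), `hEc` (edge conjugators with the branch clause, i.e. `hE` + (BR) of
the parent files in `IsEConj` form). [cite: MochizukiSemiAnbd2006, Thm 5.4, p. 66] -/
theorem isArithCompatible_piPresentation_outerAction
    (hV : ∀ (a : PA) (v : 𝒢.graph.Vertex) (H : Subgroup (𝒢.temperedPiChart h36).G),
      H ∈ verticialSubgroups (𝒢.temperedPiChart h36) v →
      ∃ φ : contMulAut (𝒢.temperedPiChart h36).G, TopOut.mk _ φ = ρ a ∧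
        H.map (φ : MulAut (𝒢.temperedPiChart h36).G).toMonoidHom ∈
          verticialSubgroups (𝒢.temperedPiChart h36) ((baseAct a).hom.vertexMap v))
    (hCT : ∀ (w : 𝒢.graph.Vertex) (n : (𝒢.galoisLevelData h36).temperedPi h36.isCountable),
      (∀ x, x ∈ ((𝒢.galoisLevelData h36).piPresentation h36.isCountable T R).H w ↔
        n⁻¹ * x * n ∈ ((𝒢.galoisLevelData h36).piPresentation h36.isCountable T R).H w) →
      n ∈ ((𝒢.galoisLevelData h36).piPresentation h36.isCountable T R).H w)
    (hG : 𝒢.graph.IsGraph)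
    (hEI : ∀ (b b' : 𝒢.graph.Branch) (w w' : 𝒢.graph.Vertex), b ≠ b' →
      𝒢.graph.edgeOf b = 𝒢.graph.edgeOf b' → 𝒢.graph.abuts b = some w → 𝒢.graph.abuts b' = some w' →
      ∀ x, x ∈ ((𝒢.galoisLevelData h36).piPresentation h36.isCountable T R).M (𝒢.graph.edgeOf b) ↔
        ((𝒢.galoisLevelData h36).piPresentation h36.isCountable T R).s b * x *
            (((𝒢.galoisLevelData h36).piPresentation h36.isCountable T R).s b)⁻¹ ∈
          ((𝒢.galoisLevelData h36).piPresentation h36.isCountable T R).H w ∧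
        ((𝒢.galoisLevelData h36).piPresentation h36.isCountable T R).s b' * x *
            (((𝒢.galoisLevelData h36).piPresentation h36.isCountable T R).s b')⁻¹ ∈
          ((𝒢.galoisLevelData h36).piPresentation h36.isCountable T R).H w')
    (hEc : ∀ (e : outerSemidirectProduct ρ) (ε : 𝒢.graph.Edge), ∃ m : (𝒢.temperedPiChart h36).G,
      ((𝒢.galoisLevelData h36).piPresentation h36.isCountable T R).IsEConj
        (((contMulAut (𝒢.temperedPiChart h36).G).subtype.comp (MonoidHom.fst _ _)).comp
          (outerSemidirectProduct ρ).subtype)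
        (baseAct.comp (outerSemidirectProductSnd ρ)) e ε m) :
    ((𝒢.galoisLevelData h36).piPresentation h36.isCountable T R).IsArithCompatible
      (((contMulAut (𝒢.temperedPiChart h36).G).subtype.comp (MonoidHom.fst _ _)).comp
        (outerSemidirectProduct ρ).subtype)
      (baseAct.comp (outerSemidirectProductSnd ρ)) where
  selfNormalizing := hCT
  abuts_isSome := hG.abuts_isSome
  edge_eq_inf := hEI
  exists_isVConj := piPresentation_exists_isVConj_outerAction h36 ρ baseAct T R hV
  exists_isEConj := hEc


/-! ### Under the hypotheses of Thm 3.7: self-normalisation of the `H_w` discharged -/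

/-- Group-theoretic bookkeeping: if `x ∈ H ↔ n⁻¹ x n ∈ H` for all `x`, then `n H n⁻¹ = H`.
[cite: MochizukiSemiAnbd2006, Thm 3.7(iii) p.41] -/
theorem map_conj_eq_of_forall_mem_iff_aux {Γ : Type u} [Group Γ] (H : Subgroup Γ) (n : Γ)
    (hn : ∀ x, x ∈ H ↔ n⁻¹ * x * n ∈ H) : H.map (MulAut.conj n).toMonoidHom = H := by
  ext y
  rw [Subgroup.mem_map]
  constructor
  · rintro ⟨x, hx, rfl⟩
    refine (hn _).2 ?_
    simpa [MulAut.conj_apply, mul_assoc] using hx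
  · intro hy
    exact ⟨n⁻¹ * y * n, (hn y).1 hy, by simp [MulAut.conj_apply, mul_assoc]⟩

section Thm37

variable (h37 : 𝒢.Thm37Hypotheses)
  (T' : ∀ w : 𝒢.graph.Vertex,
    (𝒢.galoisLevelData h37.toProp36Hypotheses).PointSeq h37.toProp36Hypotheses.isCountable w)

/-- **Field `selfNormalizing` of `IsArithCompatible` for the presentation of `𝔾` in `π₁^temp(𝒢)` —
PROVED under the hypotheses of Thm 3.7**: every `H_w = range (T w).decompHom` is self-normalising in
`π₁^temp(𝒢)`, because verticial subgroups are commensurably terminal (Thm 3.7 (iii), DISCHARGED in the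
tree: abc-iut `verticialDistinct_holds` + `mem_of_map_conj_eq_of_mem_verticialSubgroups`).
[cite: MochizukiSemiAnbd2006, Thm 3.7(iii) p.41] -/
theorem piPresentation_selfNormalizing (w : 𝒢.graph.Vertex)
    (n : (𝒢.galoisLevelData h37.toProp36Hypotheses).temperedPi h37.toProp36Hypotheses.isCountable)
    (hn : ∀ x, x ∈ ((𝒢.galoisLevelData h37.toProp36Hypotheses).piPresentation
        h37.toProp36Hypotheses.isCountable T' R).H w ↔
      n⁻¹ * x * n ∈ ((𝒢.galoisLevelData h37.toProp36Hypotheses).piPresentation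
        h37.toProp36Hypotheses.isCountable T' R).H w) :
    n ∈ ((𝒢.galoisLevelData h37.toProp36Hypotheses).piPresentation
        h37.toProp36Hypotheses.isCountable T' R).H w :=
  mem_of_map_conj_eq_of_mem_verticialSubgroups verticialDistinct_holds h37
    (𝒢.temperedPiChart h37.toProp36Hypotheses) (T' w).range_decompHom_mem_verticialSubgroups
    (map_conj_eq_of_forall_mem_iff_aux _ n hn)

/-- **`IsArithCompatible` for the presentation and the outer model under the hypotheses of Thm 3.7,
ASSEMBLED with `selfNormalizing` AND `exists_isVConj` discharged**: remaining inputs `hG` (`𝔾` a graph),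
`hEI` (Thm 3.7 (iv) clause 2 in presentation currency) and `hEc` (edge conjugators with the branch
clause; containment clause = `piPresentation_exists_eConj_fst_outerAction`).
[cite: MochizukiSemiAnbd2006, Thm 5.4, p. 66] -/
theorem isArithCompatible_piPresentation_outerAction_of_thm37
    (ρ' : PA →* TopOut (𝒢.temperedPiChart h37.toProp36Hypotheses).G)
    (hV : ∀ (a : PA) (v : 𝒢.graph.Vertex) (H : Subgroup (𝒢.temperedPiChart h37.toProp36Hypotheses).G),
      H ∈ verticialSubgroups (𝒢.temperedPiChart h37.toProp36Hypotheses) v →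
      ∃ φ : contMulAut (𝒢.temperedPiChart h37.toProp36Hypotheses).G, TopOut.mk _ φ = ρ' a ∧
        H.map (φ : MulAut (𝒢.temperedPiChart h37.toProp36Hypotheses).G).toMonoidHom ∈
          verticialSubgroups (𝒢.temperedPiChart h37.toProp36Hypotheses) ((baseAct a).hom.vertexMap v))
    (hG : 𝒢.graph.IsGraph)
    (hEI : ∀ (b b' : 𝒢.graph.Branch) (w w' : 𝒢.graph.Vertex), b ≠ b' →
      𝒢.graph.edgeOf b = 𝒢.graph.edgeOf b' → 𝒢.graph.abuts b = some w → 𝒢.graph.abuts b' = some w' →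
      ∀ x, x ∈ ((𝒢.galoisLevelData h37.toProp36Hypotheses).piPresentation
          h37.toProp36Hypotheses.isCountable T' R).M (𝒢.graph.edgeOf b) ↔
        ((𝒢.galoisLevelData h37.toProp36Hypotheses).piPresentation
              h37.toProp36Hypotheses.isCountable T' R).s b * x *
            (((𝒢.galoisLevelData h37.toProp36Hypotheses).piPresentation
              h37.toProp36Hypotheses.isCountable T' R).s b)⁻¹ ∈
          ((𝒢.galoisLevelData h37.toProp36Hypotheses).piPresentation
              h37.toProp36Hypotheses.isCountable T' R).H w ∧
        ((𝒢.galoisLevelData h37.toProp36Hypotheses).piPresentation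
              h37.toProp36Hypotheses.isCountable T' R).s b' * x *
            (((𝒢.galoisLevelData h37.toProp36Hypotheses).piPresentation
              h37.toProp36Hypotheses.isCountable T' R).s b')⁻¹ ∈
          ((𝒢.galoisLevelData h37.toProp36Hypotheses).piPresentation
              h37.toProp36Hypotheses.isCountable T' R).H w')
    (hEc : ∀ (e : outerSemidirectProduct ρ') (ε : 𝒢.graph.Edge),
      ∃ m : (𝒢.temperedPiChart h37.toProp36Hypotheses).G,
      ((𝒢.galoisLevelData h37.toProp36Hypotheses).piPresentation
          h37.toProp36Hypotheses.isCountable T' R).IsEConj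
        (((contMulAut (𝒢.temperedPiChart h37.toProp36Hypotheses).G).subtype.comp
          (MonoidHom.fst _ _)).comp (outerSemidirectProduct ρ').subtype)
        (baseAct.comp (outerSemidirectProductSnd ρ')) e ε m) :
    ((𝒢.galoisLevelData h37.toProp36Hypotheses).piPresentation
        h37.toProp36Hypotheses.isCountable T' R).IsArithCompatible
      (((contMulAut (𝒢.temperedPiChart h37.toProp36Hypotheses).G).subtype.comp
        (MonoidHom.fst _ _)).comp (outerSemidirectProduct ρ').subtype)
      (baseAct.comp (outerSemidirectProductSnd ρ')) :=
  isArithCompatible_piPresentation_outerAction h37.toProp36Hypotheses ρ' baseAct T' R hV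
    (piPresentation_selfNormalizing R h37 T') hG hEI hEc

end Thm37

/-! ### The binder `hEI` halved: `edge_eq_inf` from "the meet of the two positioned vertex groups lies in `M_e`" -/

/-- **`edge_eq_inf` reduced to its genuine content** (pure group theory over any subgroup presentation):
the direction `x ∈ M_e → s_b x s_b⁻¹ ∈ H_w ∧ s_{b'} x s_{b'}⁻¹ ∈ H_{w'}` is the presentation's own axiom
`conj_mem`; so the field `edge_eq_inf` of `IsArithCompatible` follows from the converse containment alone —
`hinf : s_b x s_b⁻¹ ∈ H_w → s_{b'} x s_{b'}⁻¹ ∈ H_{w'} → x ∈ M_e` for the two distinct branches of an edge,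
i.e. "`s_b⁻¹ H_w s_b ⊓ s_{b'}⁻¹ H_{w'} s_{b'} ≤ M_e`" ([SemiAnbd] Thm 3.7 (iv) clause 2: an edge-like subgroup IS
the intersection of the verticial subgroups at its two end-vertices — the tree's `EdgeLikeIsInfVerticial`
direction). [cite: MochizukiSemiAnbd2006, Thm 3.7(iv) p.41] -/
theorem _root_.Literature.AnabelianGeometry.SemiGraphs.SemiGraph.SubgroupPresentation.edge_eq_inf_of_inf_le
    {𝔾 : SemiGraph.{u}} {Γ : Type u} [Group Γ] (P : SemiGraph.SubgroupPresentation 𝔾 Γ)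
    (hinf : ∀ (b b' : 𝔾.Branch) (w w' : 𝔾.Vertex), b ≠ b' → 𝔾.edgeOf b = 𝔾.edgeOf b' →
      𝔾.abuts b = some w → 𝔾.abuts b' = some w' → ∀ x : Γ,
        P.s b * x * (P.s b)⁻¹ ∈ P.H w → P.s b' * x * (P.s b')⁻¹ ∈ P.H w' → x ∈ P.M (𝔾.edgeOf b)) :
    ∀ (b b' : 𝔾.Branch) (w w' : 𝔾.Vertex), b ≠ b' → 𝔾.edgeOf b = 𝔾.edgeOf b' →
      𝔾.abuts b = some w → 𝔾.abuts b' = some w' → ∀ x : Γ,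
        x ∈ P.M (𝔾.edgeOf b) ↔ P.s b * x * (P.s b)⁻¹ ∈ P.H w ∧ P.s b' * x * (P.s b')⁻¹ ∈ P.H w' := by
  intro b b' w w' hbb' he hb hb' x
  refine ⟨fun hx => ⟨P.conj_mem b w hb x hx, P.conj_mem b' w' hb' x (he ▸ hx)⟩,
    fun h => hinf b b' w w' hbb' he hb hb' x h.1 h.2⟩

/-- **`IsArithCompatible` for the presentation and the outer model under the hypotheses of Thm 3.7, with
`hEI` halved**: inputs `hV`, `hG`, the CONTAINMENT `hinf` ("`s_b⁻¹ H_w s_b ⊓ s_{b'}⁻¹ H_{w'} s_{b'} ≤ M_e`",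
Thm 3.7 (iv) clause 2 direction) and `hEc`. [cite: MochizukiSemiAnbd2006, Thm 5.4, p. 66] -/
theorem isArithCompatible_piPresentation_outerAction_of_thm37_of_inf_le (h37 : 𝒢.Thm37Hypotheses)
    (T' : ∀ w : 𝒢.graph.Vertex,
      (𝒢.galoisLevelData h37.toProp36Hypotheses).PointSeq h37.toProp36Hypotheses.isCountable w)
    (ρ' : PA →* TopOut (𝒢.temperedPiChart h37.toProp36Hypotheses).G)
    (hV : ∀ (a : PA) (v : 𝒢.graph.Vertex) (H : Subgroup (𝒢.temperedPiChart h37.toProp36Hypotheses).G),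
      H ∈ verticialSubgroups (𝒢.temperedPiChart h37.toProp36Hypotheses) v →
      ∃ φ : contMulAut (𝒢.temperedPiChart h37.toProp36Hypotheses).G, TopOut.mk _ φ = ρ' a ∧
        H.map (φ : MulAut (𝒢.temperedPiChart h37.toProp36Hypotheses).G).toMonoidHom ∈
          verticialSubgroups (𝒢.temperedPiChart h37.toProp36Hypotheses) ((baseAct a).hom.vertexMap v))
    (hG : 𝒢.graph.IsGraph)
    (hinf : ∀ (b b' : 𝒢.graph.Branch) (w w' : 𝒢.graph.Vertex), b ≠ b' →
      𝒢.graph.edgeOf b = 𝒢.graph.edgeOf b' → 𝒢.graph.abuts b = some w → 𝒢.graph.abuts b' = some w' →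
      ∀ x, ((𝒢.galoisLevelData h37.toProp36Hypotheses).piPresentation
              h37.toProp36Hypotheses.isCountable T' R).s b * x *
            (((𝒢.galoisLevelData h37.toProp36Hypotheses).piPresentation
              h37.toProp36Hypotheses.isCountable T' R).s b)⁻¹ ∈
          ((𝒢.galoisLevelData h37.toProp36Hypotheses).piPresentation
              h37.toProp36Hypotheses.isCountable T' R).H w →
        ((𝒢.galoisLevelData h37.toProp36Hypotheses).piPresentation
              h37.toProp36Hypotheses.isCountable T' R).s b' * x *
            (((𝒢.galoisLevelData h37.toProp36Hypotheses).piPresentation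
              h37.toProp36Hypotheses.isCountable T' R).s b')⁻¹ ∈
          ((𝒢.galoisLevelData h37.toProp36Hypotheses).piPresentation
              h37.toProp36Hypotheses.isCountable T' R).H w' →
        x ∈ ((𝒢.galoisLevelData h37.toProp36Hypotheses).piPresentation
              h37.toProp36Hypotheses.isCountable T' R).M (𝒢.graph.edgeOf b))
    (hEc : ∀ (e : outerSemidirectProduct ρ') (ε : 𝒢.graph.Edge),
      ∃ m : (𝒢.temperedPiChart h37.toProp36Hypotheses).G,
      ((𝒢.galoisLevelData h37.toProp36Hypotheses).piPresentation
          h37.toProp36Hypotheses.isCountable T' R).IsEConj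
        (((contMulAut (𝒢.temperedPiChart h37.toProp36Hypotheses).G).subtype.comp
          (MonoidHom.fst _ _)).comp (outerSemidirectProduct ρ').subtype)
        (baseAct.comp (outerSemidirectProductSnd ρ')) e ε m) :
    ((𝒢.galoisLevelData h37.toProp36Hypotheses).piPresentation
        h37.toProp36Hypotheses.isCountable T' R).IsArithCompatible
      (((contMulAut (𝒢.temperedPiChart h37.toProp36Hypotheses).G).subtype.comp
        (MonoidHom.fst _ _)).comp (outerSemidirectProduct ρ').subtype)
      (baseAct.comp (outerSemidirectProductSnd ρ')) :=
  isArithCompatible_piPresentation_outerAction_of_thm37 baseAct R h37 T' ρ' hV hG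
    (SemiGraph.SubgroupPresentation.edge_eq_inf_of_inf_le _ hinf) hEc

end ProfiniteSemiGraph

end Literature.AnabelianGeometry.SemiGraphs
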